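import Literature.NumberTheory.LFunctions.ZetaTwistedSecondMomentShifted
import Mathlib.NumberTheory.ArithmeticFunction.VonMangoldt
import Mathlib.NumberTheory.ArithmeticFunction.Moebius
import HarnessLib

/-!
# The shifted twisted second moment of `ζ` against a PAIR of structured Dirichlet polynomials, and the
# general Feng class `μ ⋆ Λ₁^{⋆k₁} ⋆ ⋯ ⋆ Λ_d^{⋆k_d}` at Conrey's length `θ < 4/7`
# (Pratt–Robles–Zaharescu–Zeindler 2020, Theorem 4.1)

Topic `Literature/NumberTheory/LFunctions` (namespace `Literature.NumberTheory.LFunctions`; the paper's objects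
in the existing sub-namespace `PRZZ2020` of `PRZZMollifierData.lean`, new names only). Sibling of
`ZetaTwistedSecondMomentShifted.lean` (Pratt–Robles 2018, Theorem 1.1: ONE polynomial, `|A|²`), whose conventions
it reuses verbatim — `PrattRobles2018.shiftedMoment/shiftedMainTerm/smoothFactor/Asymptotic`'s quantifier shape,
`BettinChandeeRadziwill2017.IsTestWeight/InCoeffClass`, `Literature.Barriers.RiemannHypothesis.dirichletMollifier`,
and the derivation-consistent placement of the complex conjugate in the main term (below). STATEMENT LAYER
(D-0014): ONE named fact (Theorem 4.1, its three printed cases as one conjunction, with PROVED projections and the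
PROVED reduction of its diagonal `b = a` to the shape of [PR18] Theorem 1.1), typed for the cell `landau-siegel`
(rung F-S3, family B-multi, registry row E-030 «E-multi-main(Lambda-type)»: the nearest printed technology for a
Λ-type coefficient piece paired with a smooth one is this two-polynomial moment with `μ⋆Λ^{⋆k}`-coefficients).
The programme SEARCHES and TYPES; no claim about Landau–Siegel zeros, Theorems 1–2 of arXiv:2211.02515 or a
repaired Margin232 until a kernel theorem says so.

## What the source prints (held text `paper:arxiv-1802.10521`, LaTeX source, read 2026-08-26)

K. Pratt, N. Robles, A. Zaharescu, D. Zeindler, *More than five-twelfths of the zeros of `ζ` are on the critical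
line*, Res. Math. Sci. 7 (2020) = arXiv:1802.10521 [PrattRoblesZaharescuZeindler2020]. §2 (chunk p0009): the
generalized von Mangoldt functions `Λ_k = μ ⋆ log^k`. §4 "Main result for the moment integral" (chunk p0014:L1–16):
`ψ₁(s) = Σ_{n≤N} a_n n^{−s}`, `ψ₂(s) = Σ_{n≤N} b_n n^{−s}`, "`a_n, b_n ≪_ε n^ε`, `N = T^θ` with `θ < 1`";
`I(α,β) := ∫_{−∞}^{∞} ζ(½+α+it) ζ(½+β−it) ψ₁ψ̄₂(½+it) Φ(t/T) dt`, "`α, β ≪ L^{−1}`"; the weight class (`Φ` smooth,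
supported in `[1,2]`, `Φ^{(j)} ≪_j log^j T`) is NOT restated on p0014 — it is [PR18]'s hypothesis (§1.1 (1.2)),
inherited through p0014:L41 «We assume familiarity with [pr01] and its notation» (locator per ls-lit-ref REF-C).

> **Theorem 4.1** (p0014:L17–35). Let `α, β ≪ L^{−1}`. Then one has
> `I(α,β) = ΣΣ_{1≤d,e≤N} (a_d b̄_e/[d,e]) ((d,e)^{α+β}/(d^α e^β)) ∫_{−∞}^{∞} (ζ(1+α+β) + ζ(1−α−β)(2πde/(t(d,e)²))^{α+β}) Φ(t/T) dt + O(𝓔)`,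
> with `𝓔 = T^{3/20}N^{33/20} + N^{1/2}T^{1/2+ε}` if `a_n ≪ n^ε`;
> `𝓔 = T^ε(N^{11/6} + N^{11/12}T^{1/2})` if `a_n = μ²(n)(μ ⋆ Λ₁^{⋆k₁} ⋆ Λ₂^{⋆k₂} ⋆ ⋯ ⋆ Λ_d^{⋆k_d})(n)`;
> `𝓔 = T^ε(N^{7/4} + N^{7/8}T^{1/2})` if `a_n = (μ ⋆ Λ₁^{⋆k₁} ⋆ Λ₂^{⋆k₂} ⋆ ⋯ ⋆ Λ_d^{⋆k_d})(n)`.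

Followed by (p0014:L37–39): "the second case was only proved for `d = 1`, but the below proof shows that it can be
adapted to `d ≥ 0`"; "if `d = 0` in the third case, then one recovers `μ ⋆ Λ^{⋆0} = μ`, that is the
Conrey–Levinson mollifier. This means that the Feng mollifier and all its generalizations can be taken to have size
`θ_d = 4/7 − ε` for `d ≥ 0` just as in Conrey's mollifier"; and the proof (pp. 14–16): "We need to adapt the proof
appearing in [PR18] since only the error terms are affected and the main terms remain exactly the same", run by
linearity over coefficients carrying the profile weights `P(log(N/n)/log N)` of the application (§5–§8).

## Lean rendering / design choices (audit notes for ls-lit-ref)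

* `I(α,β)` = `PRZZ2020.pairMoment φ T A B α β := ∫ ζ(½+α+it) ζ(½+β−it) A(½+it)·conj(B(½+it)) φ(t/T) dt` — the
  value conjugate, so that `B = A` is `|A(½+it)|²` = [PR18]'s `shiftedMoment` (`pairMoment_self`, PROVED).
* Main term = `PRZZ2020.pairMainTerm φ T N a b α β := Σ_{d,e≤N} (b̄_d a_e/[d,e]) ((d,e)^{α+β}/(d^α e^β)) ∫(…)Φ`.
  CONJUGATE PLACEMENT (reviewer please note): this is the tree's [PR18] convention (`ā_d a_e` with `d^α e^β`,
  `ZetaTwistedSecondMomentShifted.lean`, module docstring) with the conjugated polynomial's coefficient in the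
  `d`-slot; it is the placement the diagonal computation gives for the integrand `A(½+it)·conj B(½+it)`
  (`m d'`-pairing: `ζ(½+α+it)A` carries `(md)^{−it}`… — check on `A = 1`, `B = 2^{−s}`: main diagonal
  `2^{−1−α}ζ(1+α+β)∫Φ`, which is `b̄_2 a_1/[2,1]·(1/(2^α·1^β))` ✓ and NOT `…/(1^α 2^β)`), and it makes `b = a`
  LITERALLY [PR18]'s `shiftedMainTerm` (`pairMainTerm_self`, `rfl`). The printed display writes `a_d b̄_e` with
  `d^α e^β`, i.e. our formula with the letters `d ↔ e` and the roles `(a,α) ↔ (b̄,β)` read the other way — for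
  the printed sentence "ψ₁ψ̄₂(½+it)" both readings occur in the literature; we type the derivation-consistent one
  and record the choice, exactly as the [PR18] file did.
* "`α, β ≪ L^{−1}`", "`a_n ≪ n^ε`", `N = ⌊T^θ⌋₊` (`0 < θ < 1`), `α + β ≠ 0` (removable singularity excluded), a
  FIXED test weight `φ` with `IsTestWeight φ` -- TODO(general form): `T`-dependent weights `Φ^{(j)} ≪_j log^j T` —
  and the error shape `K·T^ε·(N^{e₁}T^{e₂} + N^{e₃}T^{e₄})`: verbatim the [PR18] file's `Asymptotic`, here with TWO
  admissibility data `i, j : ι` (one per polynomial): `PRZZ2020.PairAsymptotic`.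
* Coefficient classes: generic = `PrattRobles2018.admGeneric` (reused); the general Feng class
  `PRZZ2020.fengClass d k := μ * ∏_{j ∈ [1,d]} (genVonMangoldt j) ^ (k j)` in Mathlib's ring `ArithmeticFunction ℝ`
  (product = Dirichlet convolution; `genVonMangoldt j := μ * log.ppow j`, `genVonMangoldt_one : Λ₁ = Λ` PROVED from
  Mathlib's `moebius_mul_log_eq_vonMangoldt`; `fengClass_zero : fengClass 0 k = μ` PROVED), with exponent vector
  `k : ℕ → ℕ`. READING RECORDED: the display constrains `a_n` only and writes no profile factor; we type BOTH
  sequences in the class, each with its own data `(d, k, P)`, and WITH the profile weight `P(log(N/n)/log N)`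
  (`PRZZ2020.fengCoeff`; `P = 1` is the literal display) — this is how the theorem is proved (linearity, p. 14) and
  used (§5–§8, where both `ψ₁, ψ₂` are pieces of the same structured mollifier), and [PR18]'s three cases all
  carry `f ∈ 𝓕`; for `b` it is WEAKER than any literal reading.
* WHAT THIS IS NOT: not [PR18] Theorem 1.1 (in the tree: `prattRobles2018_theorem11`) nor its Theorems 1.2/1.3; not
  the mollified mean square `PRZZ2020_mollified_meanSquare` (an existential over mollifier data, deliberately
  without this main term); not a statement about arXiv:2211.02515, prime moduli, or Siegel zeros.

## References

* [PrattRoblesZaharescuZeindler2020] §2 (`Λ_k`), §4 Theorem 4.1 and the two paragraphs following it, pp. 14–16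
  (references.bib: this key is the interim `@misc` docstring-citation stub used tree-wide, e.g. 29× in
  `PRZZMollifierData.lean`; the journal `@article` entry is `PrattRoblesZaharescuZeindler2020RMS` — Res. Math.
  Sci. 7 (2020), no. 2 — to be merged by a one-time bib upgrade, per ls-lit-ref REF-C 2026-08-26T19:00:02Z).
* [PrattRobles2018] Theorem 1.1 (the one-polynomial case; tree: `ZetaTwistedSecondMomentShifted.lean`).
* [BettinChandeeRadziwill2017] (case 1 at `α = β = 0`); [Feng2012CriticalLine] (the coefficient shape).
-/

noncomputable section

open scoped ArithmeticFunction.Moebius ArithmeticFunction.vonMangoldt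

open Complex Finset MeasureTheory Literature.Barriers.RiemannHypothesis

namespace Literature.NumberTheory.LFunctions

open BettinChandeeRadziwill2017 PrattRobles2018

namespace PRZZ2020

/-! ### The pair moment and its printed main term -/

/-- **`I(α,β) := ∫_ℝ ζ(½+α+it) ζ(½+β−it) A(½+it) conj(B(½+it)) Φ(t/T) dt`** for any `A, B : ℂ → ℂ`
(§4, "ψ₁ψ̄₂(½+it)"; `B = A` is [PR18]'s `|A|²`, `pairMoment_self`).
[cite: PrattRoblesZaharescuZeindler2020, §4 (definition of I(α,β))] -/
def pairMoment (φ : ℝ → ℝ) (T : ℝ) (A B : ℂ → ℂ) (α β : ℂ) : ℂ :=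
  ∫ t : ℝ, riemannZeta (1 / 2 + α + t * I) * riemannZeta (1 / 2 + β - t * I) *
    (A (1 / 2 + t * I) * starRingEnd ℂ (B (1 / 2 + t * I))) * ((φ (t / T) : ℝ) : ℂ)

/-- **The printed main term of Theorem 4.1** (conjugate placement: module docstring):
`Σ_{d,e ≤ N} (b̄_d a_e/[d,e]) ((d,e)^{α+β}/(d^α e^β)) ∫_ℝ (ζ(1+α+β) + ζ(1−α−β)(2πde/(t(d,e)²))^{α+β}) Φ(t/T) dt`.
Meaningful for `α + β ≠ 0`. [cite: PrattRoblesZaharescuZeindler2020, Theorem 4.1 (main term)] -/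
def pairMainTerm (φ : ℝ → ℝ) (T : ℝ) (N : ℕ) (a b : ℕ → ℂ) (α β : ℂ) : ℂ :=
  ∑ d ∈ Icc 1 N, ∑ e ∈ Icc 1 N,
    (starRingEnd ℂ (b d) * a e / ((Nat.lcm d e : ℕ) : ℂ)) *
      (((Nat.gcd d e : ℕ) : ℂ) ^ (α + β) / ((d : ℂ) ^ α * (e : ℂ) ^ β)) *
      ∫ t : ℝ, (riemannZeta (1 + (α + β)) +
          riemannZeta (1 - (α + β)) *
            ((2 * Real.pi * d * e / (t * ((Nat.gcd d e : ℕ) : ℝ) ^ 2) : ℝ) : ℂ) ^ (α + β)) *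
        ((φ (t / T) : ℝ) : ℂ)

/-- The diagonal `B = A` of the pair moment is [PR18]'s `|A|²` moment.
[cite: PrattRoblesZaharescuZeindler2020, §4] [cite: PrattRobles2018, §1 (definition of I(α,β))] -/
theorem pairMoment_self (φ : ℝ → ℝ) (T : ℝ) (A : ℂ → ℂ) (α β : ℂ) :
    pairMoment φ T A A α β = shiftedMoment φ T A α β := by
  unfold pairMoment shiftedMoment
  congr 1
  funext t
  rw [Complex.mul_conj']
  push_cast
  ring

/-- The diagonal `b = a` of the main term is [PR18]'s main term, literally.
[cite: PrattRoblesZaharescuZeindler2020, Theorem 4.1] [cite: PrattRobles2018, Theorem 1.1] -/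
theorem pairMainTerm_self (φ : ℝ → ℝ) (T : ℝ) (N : ℕ) (a : ℕ → ℂ) (α β : ℂ) :
    pairMainTerm φ T N a a α β = shiftedMainTerm φ T N a α β := rfl

/-! ### The general Feng coefficient class `μ ⋆ Λ₁^{⋆k₁} ⋆ ⋯ ⋆ Λ_d^{⋆k_d}` -/

/-- The generalized von Mangoldt function `Λ_j = μ ⋆ log^j` (pointwise `j`-th power of `log`, Dirichlet
convolution with `μ`). [cite: PrattRoblesZaharescuZeindler2020, §2] -/
def genVonMangoldt (j : ℕ) : ArithmeticFunction ℝ :=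
  (μ : ArithmeticFunction ℝ) * ArithmeticFunction.log.ppow j

/-- `Λ₁ = Λ`. [cite: PrattRoblesZaharescuZeindler2020, §2] -/
theorem genVonMangoldt_one : genVonMangoldt 1 = ArithmeticFunction.vonMangoldt := by
  rw [genVonMangoldt, ArithmeticFunction.ppow_one, ArithmeticFunction.moebius_mul_log_eq_vonMangoldt]

/-- PRZZ's general Feng class as an arithmetic function: `μ ⋆ Λ₁^{⋆k 1} ⋆ Λ₂^{⋆k 2} ⋆ ⋯ ⋆ Λ_d^{⋆k d}`
(exponent vector `k`; ring product in `ArithmeticFunction ℝ` = Dirichlet convolution).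
[cite: PrattRoblesZaharescuZeindler2020, Theorem 4.1] -/
def fengClass (d : ℕ) (k : ℕ → ℕ) : ArithmeticFunction ℝ :=
  (μ : ArithmeticFunction ℝ) * ∏ j ∈ Icc 1 d, genVonMangoldt j ^ k j

/-- `d = 0` "recovers `μ ⋆ Λ^{⋆0} = μ`, that is the Conrey–Levinson mollifier".
[cite: PrattRoblesZaharescuZeindler2020, §4 (after Theorem 4.1)] -/
theorem fengClass_zero (k : ℕ → ℕ) : fengClass 0 k = (μ : ArithmeticFunction ℝ) := by
  simp [fengClass]

/-- **General Feng coefficients** `a_n = (μ ⋆ Λ₁^{⋆k₁} ⋆ ⋯ ⋆ Λ_d^{⋆k_d})(n)·P(log(N/n)/log N)` (third case;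
`P = 1` is the literal display). [cite: PrattRoblesZaharescuZeindler2020, Theorem 4.1 (third case)] -/
def fengCoeff (d : ℕ) (k : ℕ → ℕ) (P : Polynomial ℝ) (N : ℕ) (n : ℕ) : ℂ :=
  ((fengClass d k n * smoothFactor P N n : ℝ) : ℂ)

/-- **Squarefree general Feng coefficients** `a_n = μ²(n)(μ ⋆ Λ₁^{⋆k₁} ⋆ ⋯ ⋆ Λ_d^{⋆k_d})(n)·P(log(N/n)/log N)`
(second case). [cite: PrattRoblesZaharescuZeindler2020, Theorem 4.1 (second case)] -/
def fengSqfreeCoeff (d : ℕ) (k : ℕ → ℕ) (P : Polynomial ℝ) (N : ℕ) (n : ℕ) : ℂ :=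
  ((((μ n : ℤ) : ℝ) ^ 2 * fengClass d k n * smoothFactor P N n : ℝ) : ℂ)

/-- With `d = 0` the general Feng coefficients are [PR18]'s Conrey coefficients `μ(n)P(log(N/n)/log N)`.
[cite: PrattRoblesZaharescuZeindler2020, §4 (after Theorem 4.1)] -/
theorem fengCoeff_zero (k : ℕ → ℕ) (P : Polynomial ℝ) (N n : ℕ) :
    fengCoeff 0 k P N n = conreyCoeff P N n := by
  simp [fengCoeff, conreyCoeff, fengClass_zero, ArithmeticFunction.intCoe_apply]

/-! ### The asymptotic as a schema with two admissibility data -/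

/-- **The asymptotic of Theorem 4.1 for a pair of coefficient classes** — the [PR18] file's `Asymptotic` schema
with one admissibility datum per polynomial: for data `i, j : ι`, `0 < θ < 1`, a test weight `φ`, `Cs > 0`,
`ε > 0` there are `K, T₀` with, for all `T ≥ T₀`, all `a, b` admissible of length `N = ⌊T^θ⌋₊` for `i` resp.
`j`, and all shifts `|α|, |β| ≤ Cs/log T`, `α + β ≠ 0`:
`|I(α,β) − pairMainTerm| ≤ K·T^ε·(N^{e₁}T^{e₂} + N^{e₃}T^{e₄})`.
[cite: PrattRoblesZaharescuZeindler2020, Theorem 4.1] -/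
def PairAsymptotic (ι : Type) (adm : ι → ℕ → (ℕ → ℂ) → Prop) (e₁ e₂ e₃ e₄ : ℝ) : Prop :=
  ∀ i j : ι, ∀ θ : ℝ, 0 < θ → θ < 1 → ∀ φ : ℝ → ℝ, IsTestWeight φ →
    ∀ Cs : ℝ, 0 < Cs → ∀ ε : ℝ, 0 < ε →
      ∃ K T₀ : ℝ, ∀ T : ℝ, T₀ ≤ T → ∀ a b : ℕ → ℂ, adm i ⌊T ^ θ⌋₊ a → adm j ⌊T ^ θ⌋₊ b →
        ∀ α β : ℂ, ‖α‖ ≤ Cs / Real.log T → ‖β‖ ≤ Cs / Real.log T → α + β ≠ 0 →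
          ‖pairMoment φ T (dirichletMollifier a ⌊T ^ θ⌋₊) (dirichletMollifier b ⌊T ^ θ⌋₊) α β -
              pairMainTerm φ T ⌊T ^ θ⌋₊ a b α β‖ ≤
            K * T ^ ε * (((⌊T ^ θ⌋₊ : ℕ) : ℝ) ^ e₁ * T ^ e₂ + ((⌊T ^ θ⌋₊ : ℕ) : ℝ) ^ e₃ * T ^ e₄)

/-- General Feng admissibility: `a` IS the sequence `fengCoeff d k P N` for the data `(d, k, P)`.
[cite: PrattRoblesZaharescuZeindler2020, Theorem 4.1 (third case)] -/
def admFengClass (dkP : ℕ × (ℕ → ℕ) × Polynomial ℝ) (N : ℕ) (a : ℕ → ℂ) : Prop :=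
  a = fengCoeff dkP.1 dkP.2.1 dkP.2.2 N

/-- Squarefree general Feng admissibility. [cite: PrattRoblesZaharescuZeindler2020, Theorem 4.1 (second case)] -/
def admFengSqfreeClass (dkP : ℕ × (ℕ → ℕ) × Polynomial ℝ) (N : ℕ) (a : ℕ → ℂ) : Prop :=
  a = fengSqfreeCoeff dkP.1 dkP.2.1 dkP.2.2 N

/-- **A pair asymptotic specialises to the [PR18]-shape `|A|²` asymptotic on the diagonal `b = a`, `j = i`**
(PROVED bookkeeping: `pairMoment_self`, `pairMainTerm_self`). [cite: PrattRoblesZaharescuZeindler2020, Theorem 4.1] -/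
theorem PairAsymptotic.diag {ι : Type} {adm : ι → ℕ → (ℕ → ℂ) → Prop} {e₁ e₂ e₃ e₄ : ℝ}
    (h : PairAsymptotic ι adm e₁ e₂ e₃ e₄) : Asymptotic ι adm e₁ e₂ e₃ e₄ := by
  intro i θ hθ0 hθ1 φ hφ Cs hCs ε hε
  obtain ⟨K, T₀, hK⟩ := h i i θ hθ0 hθ1 φ hφ Cs hCs ε hε
  refine ⟨K, T₀, fun T hT a ha α β hα hβ hαβ => ?_⟩
  have h1 := hK T hT a a ha ha α β hα hβ hαβ
  rwa [pairMoment_self, pairMainTerm_self] at h1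

end PRZZ2020

open PRZZ2020

/-- **Pratt–Robles–Zaharescu–Zeindler 2020, Theorem 4.1** (NAMED FACT, AS PRINTED modulo the recorded readings,
the three cases as one conjunction): for two Dirichlet polynomials of length `N = T^θ`, `θ < 1`,
`I(α,β) = ∫ζ(½+α+it)ζ(½+β−it)ψ₁ψ̄₂(½+it)Φ(t/T)dt = [printed main term] + O(𝓔)` for `|α|, |β| ≤ Cs/log T`,
`α + β ≠ 0`, with `𝓔 ≪ T^ε(T^{3/20}N^{33/20} + N^{1/2}T^{1/2})` for `a_n, b_n ≪ n^ε` (GENERIC, `θ < 17/33`),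
`𝓔 ≪ T^ε(N^{11/6} + N^{11/12}T^{1/2})` for the squarefree general Feng class
`μ²(n)(μ⋆Λ₁^{⋆k₁}⋆⋯⋆Λ_d^{⋆k_d})(n)P(…)` (`θ < 6/11`; "only proved for `d = 1`, adaptable to `d ≥ 0`" — printed in
the theorem, kept), and `𝓔 ≪ T^ε(N^{7/4} + N^{7/8}T^{1/2})` for the general Feng class
`(μ⋆Λ₁^{⋆k₁}⋆⋯⋆Λ_d^{⋆k_d})(n)P(…)` (CONREY's range `θ < 4/7` for "the Feng mollifier and all its generalizations").
Projections `.generic/.sqfree/.feng`; diagonal ⇒ [PR18] shape via `PairAsymptotic.diag`. Status: theorem-in-print,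
not proved here. [cite: PrattRoblesZaharescuZeindler2020, Theorem 4.1] -/
def przz2020_theorem41 : Prop :=
  PairAsymptotic (ℝ → ℝ) admGeneric (33 / 20) (3 / 20) (1 / 2) (1 / 2) ∧
    PairAsymptotic (ℕ × (ℕ → ℕ) × Polynomial ℝ) admFengSqfreeClass (11 / 6) 0 (11 / 12) (1 / 2) ∧
      PairAsymptotic (ℕ × (ℕ → ℕ) × Polynomial ℝ) admFengClass (7 / 4) 0 (7 / 8) (1 / 2)

/-- The GENERIC case (`θ_max = 17/33`). [cite: PrattRoblesZaharescuZeindler2020, Theorem 4.1 (case a_n ≪ n^ε)] -/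
theorem przz2020_theorem41.generic (h : przz2020_theorem41) :
    PairAsymptotic (ℝ → ℝ) admGeneric (33 / 20) (3 / 20) (1 / 2) (1 / 2) :=
  h.1

/-- The SQUAREFREE general Feng case (`θ_max = 6/11`).
[cite: PrattRoblesZaharescuZeindler2020, Theorem 4.1 (second case)] -/
theorem przz2020_theorem41.sqfree (h : przz2020_theorem41) :
    PairAsymptotic (ℕ × (ℕ → ℕ) × Polynomial ℝ) admFengSqfreeClass (11 / 6) 0 (11 / 12) (1 / 2) :=
  h.2.1

/-- The general FENG case (`θ_max = 4/7`). [cite: PrattRoblesZaharescuZeindler2020, Theorem 4.1 (third case)] -/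
theorem przz2020_theorem41.feng (h : przz2020_theorem41) :
    PairAsymptotic (ℕ × (ℕ → ℕ) × Polynomial ℝ) admFengClass (7 / 4) 0 (7 / 8) (1 / 2) :=
  h.2.2

/-- **Consistency with the tree's [PR18] fact on the generic diagonal:** Theorem 4.1 (case 1) with `b = a` gives
the generic case of `prattRobles2018_theorem11` (same schema, same exponents).
[cite: PrattRoblesZaharescuZeindler2020, Theorem 4.1] [cite: PrattRobles2018, Theorem 1.1] -/
theorem przz2020_theorem41.generic_diag (h : przz2020_theorem41) :
    Asymptotic (ℝ → ℝ) admGeneric (33 / 20) (3 / 20) (1 / 2) (1 / 2) :=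
  h.generic.diag

end Literature.NumberTheory.LFunctions

end
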